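import Summits.Ventures.LatticeQCDFlow.Scoring.ScorerDataWindowCLT
import Summits.Ventures.LatticeQCDFlow.Scoring.MadrasSokalCoverage

/-!
# The PRINTED BAR of the scorers' EXACT statistic: asymptotic coverage at a fixed window and at scorer B's data-chosen window

HONEST FRAMING: exact (Metropolis-corrected) sampling algorithms for lattice gauge theory;
figures of merit are autocorrelation/cost numbers at stated couplings and volumes; no
continuum-physics claim.

Venture `LatticeQCDFlow` (cell pub-lqcd), sub-topic `Scoring`; FANOUT row 16 (`su2-base`), GEN-8.
NEW WORK of the cell — the centred (`acovHatC`) counterpart of GEN-7's `MadrasSokalCoverage`: the same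
plug-in argument (row 13's `Exactness.GeneralNCMC.tendsto_measure_abs_mul_le_of_clt_of_tendstoInMeasure`,
GEN-7's `msScale`) on GEN-8's `ScorerTauIntCLT` (fixed window) and `ScorerDataWindowCLT` (scorer B's
data-chosen window).  No definition; nothing cited as a fact.

With `τ̂^c_N(W) = tauIntWindow (Γ̂_c(·)/Γ̂_c(0)) W` (mean-subtracted, `1/(N−t)` — what both scorers compute),
scorer B's printed bar `δτ_B = τ̂ √((4W+2)/N)` and its null-safe studentising factor `B(τ) = msScale W τ`:

* **`tendsto_measure_printedBarC`** — fixed `W`, `γ(0) ≠ 0`, `τ_W ≠ 0`: the probability of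
  `|√N (τ̂^c_N(W) − τ_W) · B(τ̂^c_N(W))| ≤ z` converges to `N(0, R_c/((4W+2) τ_W²))([−z, z])`,
  `R_c = ℓᵀ Σ_c ℓ` the centred-process CLT variance.
* **`tendsto_measure_printedBarC_at_msWindowSel`** — the same limit for the event read at scorer B's
  data-chosen window `Ŵ_N = msWindowSel c Wmax (τ̂^c_N(·))` at a strict population crossing `w ≤ Wmax`.

NOT CLAIMED: anything beyond GEN-7's NOT-CLAIMED list for the uncentred statistic; numbers.
-/

noncomputable section

open MeasureTheory ProbabilityTheory Filter Finset WithLp Set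
open scoped Topology ENNReal RealInnerProductSpace

namespace Summit.Ventures.LatticeQCDFlow.Scoring

section Coverage

variable {Ω : Type*} [MeasurableSpace Ω] {P : Measure Ω} [IsProbabilityMeasure P]
variable {Ω' : Type*} [MeasurableSpace Ω'] {P' : Measure Ω'} [IsProbabilityMeasure P']
variable {S : Type*} [MeasurableSpace S] {ξ : ℕ → Ω → S} {m : ℕ} {F : (Fin (m + 1) → S) → ℝ}

/-- **ASYMPTOTIC COVERAGE OF THE PRINTED BAR FOR THE SCORERS' EXACT STATISTIC (fixed window).** -/
theorem tendsto_measure_printedBarC (hξ : ∀ i, Measurable (ξ i)) (hind : iIndepFun ξ P)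
    (hid : ∀ i, IdentDistrib (ξ i) (ξ 0) P P) (hF : Measurable F)
    (h2 : MemLp (blockFactor F ξ 0) 2 P)
    (h4c : ∀ t, MemLp (fun ω => (blockFactor F ξ 0 ω - P[blockFactor F ξ 0])
      * (blockFactor F ξ t ω - P[blockFactor F ξ 0])) 2 P) (W : ℕ)
    (hσ : P[fun ω => (blockFactor F ξ 0 ω - P[blockFactor F ξ 0])
      * (blockFactor F ξ 0 ω - P[blockFactor F ξ 0])] ≠ 0)
    (hτ : tauIntWindow (fun t => P[fun ω => (blockFactor F ξ 0 ω - P[blockFactor F ξ 0])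
          * (blockFactor F ξ t ω - P[blockFactor F ξ 0])]
        / P[fun ω => (blockFactor F ξ 0 ω - P[blockFactor F ξ 0])
          * (blockFactor F ξ 0 ω - P[blockFactor F ξ 0])]) W ≠ 0)
    {Z : Ω' → EuclideanSpace ℝ (Fin (W + 1))} (hZm : AEMeasurable Z P')
    (hZ : ∀ a : EuclideanSpace ℝ (Fin (W + 1)), HasLaw (fun ω' => ⟪a, Z ω'⟫) (gaussianReal 0
      (∑ s : Fin (W + 1), ∑ t : Fin (W + 1), a s * a t
        * lagProdACov (fun i ω => blockFactor F ξ i ω - P[blockFactor F ξ 0]) P (m + W) s t).toNNReal)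
      P') {z : ℝ} (hz : 0 < z) :
    Tendsto (fun N : ℕ => P {ω | |Real.sqrt N
        * (tauIntWindow (fun t => acovHatC (blockFactor F ξ) N t ω / acovHatC (blockFactor F ξ) N 0 ω) W
          - tauIntWindow (fun t => P[fun ω => (blockFactor F ξ 0 ω - P[blockFactor F ξ 0])
              * (blockFactor F ξ t ω - P[blockFactor F ξ 0])]
            / P[fun ω => (blockFactor F ξ 0 ω - P[blockFactor F ξ 0])
              * (blockFactor F ξ 0 ω - P[blockFactor F ξ 0])]) W)
        * msScale W (tauIntWindow (fun t => acovHatC (blockFactor F ξ) N t ω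
            / acovHatC (blockFactor F ξ) N 0 ω) W)| ≤ z}) atTop
      (𝓝 (gaussianReal 0 (NNReal.mk (msScale W (tauIntWindow (fun t =>
          P[fun ω => (blockFactor F ξ 0 ω - P[blockFactor F ξ 0]) * (blockFactor F ξ t ω - P[blockFactor F ξ 0])]
            / P[fun ω => (blockFactor F ξ 0 ω - P[blockFactor F ξ 0])
              * (blockFactor F ξ 0 ω - P[blockFactor F ξ 0])]) W) ^ 2) (sq_nonneg _)
        * (∑ s : Fin (W + 1), ∑ t : Fin (W + 1),
            tauHatGrad W (toLp 2 fun t : Fin (W + 1) =>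
              P[fun ω => (blockFactor F ξ 0 ω - P[blockFactor F ξ 0])
                * (blockFactor F ξ t ω - P[blockFactor F ξ 0])]) s
            * tauHatGrad W (toLp 2 fun t : Fin (W + 1) =>
              P[fun ω => (blockFactor F ξ 0 ω - P[blockFactor F ξ 0])
                * (blockFactor F ξ t ω - P[blockFactor F ξ 0])]) t
            * lagProdACov (fun i ω => blockFactor F ξ i ω - P[blockFactor F ξ 0]) P (m + W) s t).toNNReal)
        (Icc (-z) z))) := by
  have hclt := tendstoInDistribution_tauIntWindow_acovHatC hξ hind hid hF h2 h4c W hσ hZm hZ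
  have hlaw := hasLaw_inner_tauHatGrad hZ (toLp 2 fun t : Fin (W + 1) =>
    P[fun ω => (blockFactor F ξ 0 ω - P[blockFactor F ξ 0]) * (blockFactor F ξ t ω - P[blockFactor F ξ 0])])
  have hcons := tendstoInMeasure_tauIntWindowC_blockFactor hξ hind hid hF h2 h4c hσ W
  have hB := CardConsistency.tendstoInMeasure_comp_continuousAt hcons (continuousAt_msScale W hτ)
  have hBm : ∀ N : ℕ, Measurable fun ω => msScale W (tauIntWindow (fun t =>
      acovHatC (blockFactor F ξ) N t ω / acovHatC (blockFactor F ξ) N 0 ω) W) :=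
    fun N => (measurable_msScale W).comp (measurable_tauIntWindow_acovHatC hξ hF N W)
  exact Exactness.GeneralNCMC.tendsto_measure_abs_mul_le_of_clt_of_tendstoInMeasure hBm hlaw hclt hB hz

/-- **… AND AT SCORER B's DATA-CHOSEN WINDOW**: the same limit for the event read at
`Ŵ_N = msWindowSel c Wmax (τ̂^c_N(·))`, at a strict population crossing `w ≤ Wmax` (`c > 0`). -/
theorem tendsto_measure_printedBarC_at_msWindowSel (hξ : ∀ i, Measurable (ξ i))
    (hind : iIndepFun ξ P) (hid : ∀ i, IdentDistrib (ξ i) (ξ 0) P P) (hF : Measurable F)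
    (h2 : MemLp (blockFactor F ξ 0) 2 P)
    (h4c : ∀ t, MemLp (fun ω => (blockFactor F ξ 0 ω - P[blockFactor F ξ 0])
      * (blockFactor F ξ t ω - P[blockFactor F ξ 0])) 2 P)
    (hσ : P[fun ω => (blockFactor F ξ 0 ω - P[blockFactor F ξ 0])
      * (blockFactor F ξ 0 ω - P[blockFactor F ξ 0])] ≠ 0) {c : ℝ} (hc : 0 < c)
    {w Wmax : ℕ} (hwle : w ≤ Wmax)
    (hw : IsStrictMSWindow c (fun W => tauIntWindow (fun t =>
      P[fun ω => (blockFactor F ξ 0 ω - P[blockFactor F ξ 0]) * (blockFactor F ξ t ω - P[blockFactor F ξ 0])]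
        / P[fun ω => (blockFactor F ξ 0 ω - P[blockFactor F ξ 0])
          * (blockFactor F ξ 0 ω - P[blockFactor F ξ 0])]) W) w)
    (hτ : tauIntWindow (fun t => P[fun ω => (blockFactor F ξ 0 ω - P[blockFactor F ξ 0])
          * (blockFactor F ξ t ω - P[blockFactor F ξ 0])]
        / P[fun ω => (blockFactor F ξ 0 ω - P[blockFactor F ξ 0])
          * (blockFactor F ξ 0 ω - P[blockFactor F ξ 0])]) w ≠ 0)
    {Z : Ω' → EuclideanSpace ℝ (Fin (w + 1))} (hZm : AEMeasurable Z P')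
    (hZ : ∀ a : EuclideanSpace ℝ (Fin (w + 1)), HasLaw (fun ω' => ⟪a, Z ω'⟫) (gaussianReal 0
      (∑ s : Fin (w + 1), ∑ t : Fin (w + 1), a s * a t
        * lagProdACov (fun i ω => blockFactor F ξ i ω - P[blockFactor F ξ 0]) P (m + w) s t).toNNReal)
      P') {z : ℝ} (hz : 0 < z) :
    Tendsto (fun N : ℕ => P {ω |
        |Real.sqrt N
          * (tauIntWindow (fun t => acovHatC (blockFactor F ξ) N t ω / acovHatC (blockFactor F ξ) N 0 ω)
              (msWindowSel c Wmax (fun W => tauIntWindow (fun t =>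
                acovHatC (blockFactor F ξ) N t ω / acovHatC (blockFactor F ξ) N 0 ω) W))
            - tauIntWindow (fun t => P[fun ω => (blockFactor F ξ 0 ω - P[blockFactor F ξ 0])
                * (blockFactor F ξ t ω - P[blockFactor F ξ 0])]
              / P[fun ω => (blockFactor F ξ 0 ω - P[blockFactor F ξ 0])
                * (blockFactor F ξ 0 ω - P[blockFactor F ξ 0])])
              (msWindowSel c Wmax (fun W => tauIntWindow (fun t =>
                acovHatC (blockFactor F ξ) N t ω / acovHatC (blockFactor F ξ) N 0 ω) W)))
          * msScale (msWindowSel c Wmax (fun W => tauIntWindow (fun t =>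
                acovHatC (blockFactor F ξ) N t ω / acovHatC (blockFactor F ξ) N 0 ω) W))
              (tauIntWindow (fun t => acovHatC (blockFactor F ξ) N t ω
                / acovHatC (blockFactor F ξ) N 0 ω)
                (msWindowSel c Wmax (fun W => tauIntWindow (fun t =>
                  acovHatC (blockFactor F ξ) N t ω / acovHatC (blockFactor F ξ) N 0 ω) W)))| ≤ z})
      atTop
      (𝓝 (gaussianReal 0 (NNReal.mk (msScale w (tauIntWindow (fun t =>
          P[fun ω => (blockFactor F ξ 0 ω - P[blockFactor F ξ 0]) * (blockFactor F ξ t ω - P[blockFactor F ξ 0])]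
            / P[fun ω => (blockFactor F ξ 0 ω - P[blockFactor F ξ 0])
              * (blockFactor F ξ 0 ω - P[blockFactor F ξ 0])]) w) ^ 2) (sq_nonneg _)
        * (∑ s : Fin (w + 1), ∑ t : Fin (w + 1),
            tauHatGrad w (toLp 2 fun t : Fin (w + 1) =>
              P[fun ω => (blockFactor F ξ 0 ω - P[blockFactor F ξ 0])
                * (blockFactor F ξ t ω - P[blockFactor F ξ 0])]) s
            * tauHatGrad w (toLp 2 fun t : Fin (w + 1) =>
              P[fun ω => (blockFactor F ξ 0 ω - P[blockFactor F ξ 0])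
                * (blockFactor F ξ t ω - P[blockFactor F ξ 0])]) t
            * lagProdACov (fun i ω => blockFactor F ξ i ω - P[blockFactor F ξ 0]) P (m + w) s t).toNNReal)
        (Icc (-z) z))) := by
  set τhat : ℕ → ℕ → Ω → ℝ := fun N W ω => tauIntWindow (fun t => acovHatC (blockFactor F ξ) N t ω
      / acovHatC (blockFactor F ξ) N 0 ω) W with hτhat
  set τW : ℕ → ℝ := fun W => tauIntWindow (fun t =>
      P[fun ω => (blockFactor F ξ 0 ω - P[blockFactor F ξ 0]) * (blockFactor F ξ t ω - P[blockFactor F ξ 0])]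
        / P[fun ω => (blockFactor F ξ 0 ω - P[blockFactor F ξ 0])
          * (blockFactor F ξ 0 ω - P[blockFactor F ξ 0])]) W with hτW
  set A : ℕ → ℕ → Set Ω := fun N W =>
    {ω | |Real.sqrt N * (τhat N W ω - τW W) * msScale W (τhat N W ω)| ≤ z} with hA
  have hfixed := tendsto_measure_printedBarC hξ hind hid hF h2 h4c w hσ hτ hZm hZ hz
  have hconv : ∀ W, 1 ≤ W → W ≤ w → TendstoInMeasure P (fun N => τhat N W) atTop fun _ => τW W :=
    fun W _ _ => tendstoInMeasure_tauIntWindowC_blockFactor hξ hind hid hF h2 h4c hσ W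
  have hsel : ∀ N ω, IsMSWindow c (fun W => τhat N W ω) w →
      msWindowSel c Wmax (fun W => τhat N W ω) = w :=
    fun _ _ h => msWindowSel_eq_of_isMSWindow h hwle
  exact tendsto_measure_at_msWindow (A := A) hfixed hc hw hconv hsel

end Coverage

end Summit.Ventures.LatticeQCDFlow.Scoring

end
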